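import Summits.QuantumFields.YangMills.Theorems.AlphaInputsT3ACv3ProfileRegionEML
import Summits.QuantumFields.YangMills.Theorems.AlphaInputsT3ACv3AbelianCurlIter
import Summits.QuantumFields.YangMills.Theorems.AlphaInputsT3ACv3CoreNonemptyE
import Summits.QuantumFields.YangMills.Theorems.AlphaInputsT3ACv3RecordSelXsChi
import HarnessLib

/-!
# `AlphaInputsT3ACv3ProfileLargeRec` — STRATEGY B for 2′χ, (U2) PART 2: **THE ENLARGED-REGION PROFILE IS `h`-LARGE IN RECORDING CURRENCY** — `g_jp(g_j) ≤ |Ū^{(j)}(profE)(∂p′) − 1|`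
# at every recorded `p′ ∈ P_j(h)`, `Ū^{(j)}` the `j`-fold SYMMETRIC (0.4)∕`exp[mean log]` average of record; whence ★★★ `AlphaInputsT3AC.profE_mem_large67RecSet` and the row (U2)
# `AlphaInputsT3AC.profRec_of_collar` = ★w5-19936 g4's displayed `hU2` VERBATIM — cell `ym3-torus`, width seat `ym-ust-19936-w4` (g5)

WHY (cell bus 2026-08-28: LEAD ★w1-19936 g3 card v1.2∕v1.3 §residue (E2)→(U2); ★★OWNER RULING g26-№8 (1)(α); ★w5-19936 g4 ⧗p623726 `…v3ChargedGlueXs` §5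
`exists_inClassSelT3Xs_of_innerLift_of_collar_of_profRec (hU2)`).  The comb-currency largeness ✓ `hLarge_profE` ([B7] average on `ηℤ³`) does not serve the Sel∕Xs class `𝒞_Xs`
of record, whose (67) conjunct `large67RecSet` reads the torus-side symmetric average.  THIS FILE proves the recording-currency largeness with the SAME number — flux-rigidity makes
the two currencies see the same averaged curl `amp_j·((L^j)² + 1)∕2` at a recorded plaquette: §1 the exact curl of the real iterate (this seat's ✓ `AbelianEML.curlAt_linAvgIter_eq_blockSum`)
of `potTE` at `p′` is the rigid block sum of the pattern curls `amp_j·σ_{L^j}` over `Δ′(p′)` (✓ `curl_potZE_eq_on_deltaBox`, ✓ `curl_patPot`, stripes by ✓ `sum_box_range`) =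
`amp_j·tent_{L^j}σ(z(p′)_ν)`, of size `amp_j((L^j)²+1)∕2` (✓ `abs_tent_sig`); §2 with the sibling's ✓ `plaqHol_iter_blockAvg_profE_eq` the lower bound `(2∕π)|Φ|‖X‖ ≤ ‖e^{ΦX} − 1‖`
and `4π ≤ C68` close exactly as in `hLarge_profE`: ★★ `eps1Of_le_dist1_plaqHol_iter_profE`; §3 at the T³ objects (window ⇐ ✓ `b7Window_T3`, `C₀(3) ≥ 25`, `δ_{SU(2)} = ⅓`):
★★★ `AlphaInputsT3AC.profE_mem_large67RecSet`, `AlphaInputsT3AC.profRec_of_collar`.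
HONEST FRAMING.  Kernel estimates for a CONSTRUCTED test configuration; nothing of [B10]∕[7]∕[4]'s estimates asserted; def-free; count-neutral helper toward R3 2′χ (`HistoryTailL`,
item 19936 — NOT proved here: T8, NODE O's rows and the stub stay where they are); registry untouched (J r4).  YM₃ on T³ is rung R3 of the programme (finite-torus SU(2)), not
T⁴, not the continuum, not the Clay problem; no mass gap is claimed.

References: T. Bałaban, Commun. Math. Phys. 102 (1985) 255–275 [Balaban1985UV3] ((7) p.257, (40) p.266, (67)–(70) p.273); CMP 109 (1987) 249–301 [Balaban1987RG1] ((0.4),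
(0.11) p.253); CMP 98 (1985) 17–51 [Balaban1985Averaging] ((14) p.19, (24)–(25) p.21, Prop. 2 (52)–(54) p.26).
-/

set_option autoImplicit false

noncomputable section

open scoped BigOperators Matrix.Norms.L2Operator

namespace Summit.QuantumFields.YangMills.Theorems.ProfileEnlarged

open Finset NormedSpace
open Literature.MathematicalPhysics.QuantumFieldTheory.Balaban1983to89
open Literature.MathematicalPhysics.QuantumFieldTheory.Balaban1983to89.T4Continuum
open Literature.MathematicalPhysics.QuantumFieldTheory.Balaban1983to89.BlockAveraging (blockAvg)
open Literature.MathematicalPhysics.QuantumFieldTheory.Balaban1983to89.LatticeFieldCalculus (runSite runSite_zero runSite_succ)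
open Literature.MathematicalPhysics.QuantumFieldTheory.Balaban1983to89.ExpMeanLog (expMeanLogSU deltaSU deltaSU_pos)
open Literature.MathematicalPhysics.QuantumFieldTheory.Balaban1983to89.B10 (pFun)
open Literature.MathematicalPhysics.QuantumFieldTheory.Balaban1985CMP102
open Literature.MathematicalPhysics.QuantumFieldTheory.Balaban1985CMP102.Setting
open Summit.QuantumFields.Balaban3D.Carriers
open Summit.QuantumFields.Balaban3D.Proofs.Primitives (AlphaConsts)
open Summit.QuantumFields.Balaban3D.Proofs.TorusLift (projSite zOf projSite_add_e zOf_apply)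
open Summit.QuantumFields.Balaban3D.Proofs.GroupModelSkew (conjTranspose_eq_neg_of_mem_lie)
open Summit.QuantumFields.YangMills.Theorems.BalabanUVNodesN08AlphaAbelianLift (gexp gexp_add gexp_inv abs_mul_norm_le_of_exp)
open Summit.QuantumFields.YangMills.Theorems.BalabanUVNodesN08AlphaAbelianAverage (curl sum_box_range tent)
open Summit.QuantumFields.YangMills.Theorems.BalabanUVNodesN08AlphaPattern (sig patPot curl_patPot abs_tent_sig)
open Summit.QuantumFields.YangMills.Theorems.BalabanUVNodesN08AlphaProfileBuild (aj aj_pos amp amp_nonneg labZ)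
open Summit.QuantumFields.YangMills.Theorems.BalabanUVNodesN08AlphaProfileLarge (mem_deltaBox_of_bounds)
open Summit.QuantumFields.YangMills.Theorems.BalabanUVNodesN08AlphaLiftAvgCont (sitesPerDir_zero_eq)
open Summit.QuantumFields.YangMills.Theorems.AbelianEML (gexpAt curlAt linAvgIter dist1_gexp curlAt_linAvgIter_eq_blockSum)
open Summit.QuantumFields.YangMills.Theorems.Prop7FlatCoercivity (fibreSite_runSite)
open Summit.QuantumFields.YangMills.Theorems.SymAvgBlockSum69 (projSite_add_natCast_smul_e projSite_nsmul_zOf_add_boxVec)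
open B7Prop1Explicit (e e_apply boxVec)
open B10Eq70Squaring (deltaBox)

variable {L : ℕ} (S : Scales L)

/-! ## §1 The exact curl of the iterated linear average of `potTE` at a recorded plaquette: the pattern's tent sum -/

section Pattern

variable {G : Type} [GaugeGroup G] [MeasurableSpace G] {𝔊 : GroupModel G} (𝔠 : AlphaConsts L 𝔊.N)
  (X : Matrix (Fin 𝔊.N) (Fin 𝔊.N) ℂ) {k : ℕ} (h : Hist S.P k)

/-- **★ THE CURL OF `linAvgIter j potTE` AT A RECORDED PLAQUETTE IS `amp_j · tent_{L^j} σ_{L^j} (z(p′)_ν)`** — the rigid block sum (`curlAt_linAvgIter_eq_blockSum`) of the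
pattern curls `amp_j·σ_{L^j}(x_ν)` over `Δ′(p′)` (`curl_potZE_eq_on_deltaBox`, `curl_patPot`), summed by stripes (`sum_box_range`): the SAME number as the comb side's
`curl (linAvgIter L potZE j)(zOf p′)` (✓ `abs_curl_linAvgIter_potZE`). [cite: Balaban1985UV3, (69)–(70) p.273; Balaban1985Averaging, (14) p.19] -/
theorem curlAt_linAvgIter_potTE_eq (hk : k ≤ S.K) (hR : CollarE S 𝔠 k)
    (hadm : Hist.Admissible 𝔠.lane.carrier.M₁ (rcolOf S 𝔠.lane.carrier) k h) {j : ℕ} (hj : j < k) {p : Plaq S.P j} (hp : p ∈ h ⟨j, hj⟩) :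
    curlAt (linAvgIter j (potTE S 𝔠 X h)) p.src p.μ p.ν = amp S 𝔠 X j * tent (L ^ j) (sig (L ^ j)) (zOf p p.ν) := by
  have hkm : k ≤ S.P.m + S.P.K := le_trans hk (Nat.le_add_left _ _)
  have hjm : j ≤ S.P.m + S.P.K := by omega
  have hPL : S.P.L = L := rfl
  have hμν : p.μ ≠ p.ν := ne_of_lt p.hμν
  rw [curlAt_linAvgIter_eq_blockSum hjm]
  -- each fine curl is the pattern curl at the integer representative
  have hterm : ∀ (r : Fin S.P.d → Fin (S.P.L ^ j)) (a b : ℕ), a < S.P.L ^ j → b < S.P.L ^ j →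
      curlAt (potTE S 𝔠 X h) (runSite (runSite (Site.fibreSite 0 j p.src r) p.μ a) p.ν b) p.μ p.ν =
        amp S 𝔠 X j * sig (L ^ j) ((S.P.L : ℤ) ^ j * zOf p p.ν + ((r p.ν : ℕ) : ℤ) + (b : ℤ)) := by
    intro r a b ha hb
    have hproj : projSite (P := S.P) ((S.P.L ^ j : ℕ) • zOf p + boxVec (S.P.L ^ j) r + ((a : ℕ) : ℤ) • e p.μ + ((b : ℕ) : ℤ) • e p.ν) =
        runSite (runSite (Site.fibreSite 0 j p.src r) p.μ a) p.ν b := by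
      rw [projSite_add_natCast_smul_e, projSite_add_natCast_smul_e, projSite_nsmul_zOf_add_boxVec]
    have hΔ : (S.P.L ^ j : ℕ) • zOf p + boxVec (S.P.L ^ j) r + ((a : ℕ) : ℤ) • e p.μ + ((b : ℕ) : ℤ) • e p.ν ∈
        deltaBox (S.P.L ^ j) ((S.P.L ^ j : ℕ) • zOf p) p.μ p.ν := by
      refine mem_deltaBox_of_bounds S p fun i => ?_
      have hri : ((r i : ℕ) : ℤ) < (S.P.L : ℤ) ^ j := by exact_mod_cast (r i).isLt
      have hr0 : (0 : ℤ) ≤ ((r i : ℕ) : ℤ) := by exact_mod_cast Nat.zero_le _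
      have ha' : ((a : ℕ) : ℤ) < (S.P.L : ℤ) ^ j := by exact_mod_cast ha
      have hb' : ((b : ℕ) : ℤ) < (S.P.L : ℤ) ^ j := by exact_mod_cast hb
      have ha0 : (0 : ℤ) ≤ ((a : ℕ) : ℤ) := by exact_mod_cast Nat.zero_le _
      have hb0 : (0 : ℤ) ≤ ((b : ℕ) : ℤ) := by exact_mod_cast Nat.zero_le _
      have hyi : ((S.P.L ^ j : ℕ) • zOf p + boxVec (S.P.L ^ j) r + ((a : ℕ) : ℤ) • e p.μ + ((b : ℕ) : ℤ) • e p.ν) i =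
          (S.P.L : ℤ) ^ j * zOf p i + ((r i : ℕ) : ℤ) + (((a : ℕ) : ℤ) * (if i = p.μ then 1 else 0) + ((b : ℕ) : ℤ) * (if i = p.ν then 1 else 0)) := by
        simp only [Pi.add_apply, Pi.smul_apply, Pi.mul_apply, Pi.natCast_apply, boxVec, e_apply, smul_eq_mul, nsmul_eq_mul]
        push_cast
        ring
      rw [hyi]
      by_cases hiμ : i = p.μ
      · rw [if_pos hiμ, if_neg (fun hiν => hμν (hiμ.symm.trans hiν)), if_pos (Or.inl hiμ)]
        constructor <;> nlinarith
      · by_cases hiν : i = p.ν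
        · rw [if_neg hiμ, if_pos hiν, if_pos (Or.inr hiν)]
          constructor <;> nlinarith
        · rw [if_neg hiμ, if_neg hiν, if_neg (not_or.mpr ⟨hiμ, hiν⟩)]
          constructor <;> nlinarith
    rw [← hproj, curlAt_potTE_projSite S 𝔠 X h hkm, curl_potZE_eq_on_deltaBox S 𝔠 X h hk hR hadm hj hp hΔ, curl_patPot _ _ _ p.hμν]
    congr 2
    simp only [Pi.add_apply, Pi.smul_apply, Pi.mul_apply, Pi.natCast_apply, boxVec, e_apply, smul_eq_mul, nsmul_eq_mul,
      if_neg (Ne.symm hμν), hPL]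
    push_cast
    ring
  -- sum the stripes
  set M : ℕ := S.P.L ^ j with hM
  have hsum : ∑ r : Fin S.P.d → Fin M, ∑ a' ∈ range M, ∑ b' ∈ range M,
      curlAt (potTE S 𝔠 X h) (runSite (runSite (Site.fibreSite 0 j p.src r) p.μ a') p.ν b') p.μ p.ν =
      amp S 𝔠 X j * ((M : ℝ) * ((M : ℝ) ^ (S.P.d - 1) * tent M (sig (L ^ j)) (zOf p p.ν))) := by
    have step1 : ∀ r : Fin S.P.d → Fin M, ∑ a' ∈ range M, ∑ b' ∈ range M,
        curlAt (potTE S 𝔠 X h) (runSite (runSite (Site.fibreSite 0 j p.src r) p.μ a') p.ν b') p.μ p.ν =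
        (M : ℝ) * ∑ b' ∈ range M, amp S 𝔠 X j * sig (L ^ j) ((M : ℤ) * zOf p p.ν + ((r p.ν : ℕ) : ℤ) + (b' : ℤ)) := by
      intro r
      have hM' : ((M : ℕ) : ℤ) = (S.P.L : ℤ) ^ j := by rw [hM]; push_cast; rfl
      rw [Finset.sum_congr rfl fun a' ha' => Finset.sum_congr rfl fun b' hb' =>
        hterm r a' b' (Finset.mem_range.mp ha') (Finset.mem_range.mp hb'), Finset.sum_const, Finset.card_range, nsmul_eq_mul, hM']
    simp_rw [step1, ← Finset.mul_sum]
    rw [sum_box_range M p.ν (sig (L ^ j)) ((M : ℤ) * zOf p p.ν)]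
    unfold tent
    ring
  rw [hsum]
  have hML : M = L ^ j := hM
  have hLj0 : ((L ^ j : ℕ) : ℝ) ≠ 0 := by
    have : 0 < L ^ j := pow_pos (lt_trans zero_lt_one S.hL.2) j
    exact_mod_cast this.ne'
  have hd : S.P.d = (S.P.d - 1) + 1 := by
    have h3 : S.P.d = 3 := rfl
    omega
  have hMd : ((S.P.L : ℝ) ^ j) ^ S.P.d = ((L ^ j : ℕ) : ℝ) * ((L ^ j : ℕ) : ℝ) ^ (S.P.d - 1) := by
    rw [hPL]
    push_cast
    conv_lhs => rw [hd, pow_succ]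
    ring
  rw [hMd, hML]
  field_simp

/-- **★ ITS SIZE IS `amp_j·((L^j)² + 1)∕2`** (`L` odd: ✓ `abs_tent_sig`) — the same as `|curl (linAvgIter L potZE j)(zOf p′)|` of the comb side. [cite: Balaban1985UV3, (69)–(70) p.273] -/
theorem abs_curlAt_linAvgIter_potTE (hX0 : X ≠ 0) (hk : k ≤ S.K) (hR : CollarE S 𝔠 k)
    (hadm : Hist.Admissible 𝔠.lane.carrier.M₁ (rcolOf S 𝔠.lane.carrier) k h) {j : ℕ} (hj : j < k) {p : Plaq S.P j} (hp : p ∈ h ⟨j, hj⟩) :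
    |curlAt (linAvgIter j (potTE S 𝔠 X h)) p.src p.μ p.ν| = amp S 𝔠 X j * ((((L : ℝ) ^ j) ^ 2 + 1) / 2) := by
  rw [curlAt_linAvgIter_potTE_eq S 𝔠 X h hk hR hadm hj hp, abs_mul, abs_of_nonneg (amp_nonneg S 𝔠 hX0 (by omega)), abs_tent_sig (S.hL.1.pow)]
  push_cast
  ring

end Pattern

/-! ## §2 The enlarged-region profile is `h`-large in recording currency -/

section LargeRec

variable {N : ℕ} [NeZero N] (𝔠 : AlphaConsts L (suGroupModel N).N) {X : Matrix (Fin (suGroupModel N).N) (Fin (suGroupModel N).N) ℂ}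
  (hX : X ∈ (suGroupModel N).lie) {k : ℕ} (h : Hist S.P k)

/-- **★★ THE ENLARGED-REGION PROFILE IS `h`-LARGE IN RECORDING CURRENCY**: at every recorded plaquette `(j, p′)` of the admissible history,
`g_jp(g_j) = eps1Of j ≤ |Ū^{(j)}(profE)(∂p′) − 1|`, the average being the `j`-fold SYMMETRIC `(blockAvg ℰp)^j` of (0.4) with `exp[mean log]` on `SU(N)` — given the collars (N2′),
the window `(d+2)²·C68·g_ip(g_i) ≤ δ_N` on the recorded scales and `C68 ≥ 4π`.  Twin of ✓ `hLarge_profE` (comb currency) with the same number `amp_j((L^j)²+1)∕2`.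
[cite: Balaban1985UV3, (7) p.257 + (40) p.266 + (67) p.273 L13; Balaban1987RG1, (0.4) p.253] -/
theorem eps1Of_le_dist1_plaqHol_iter_profE (hX0 : X ≠ 0) (hk : k ≤ S.K) (hR : CollarE S 𝔠 k)
    (hwin : ∀ i, i < k → ((S.P.d : ℝ) + 2) ^ 2 * (𝔠.C68 * aj S 𝔠 i) ≤ deltaSU (Fin N)) (hC : 4 * Real.pi ≤ 𝔠.C68)
    (hadm : Hist.Admissible 𝔠.lane.carrier.M₁ (rcolOf S 𝔠.lane.carrier) k h) {j : ℕ} (hj : j < k) {p : Plaq S.P j} (hp : p ∈ h ⟨j, hj⟩) :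
    eps1Of S 𝔠.lane.carrier j ≤
      dist1 (GaugeField.plaqHol (Averaging.iter (fun i => blockAvg (P := S.P) (j := i) (expMeanLogSU (n := Fin N))) j (profE S 𝔠 h hX)) p) := by
  rw [plaqHol_iter_blockAvg_profE_eq S 𝔠 hX h hX0 hk hR hwin hadm hj hp, dist1_gexp]
  have hskew := conjTranspose_eq_neg_of_mem_lie (suGroupModel N) hX
  set F : ℝ := curlAt (linAvgIter j (potTE S 𝔠 X h)) p.src p.μ p.ν with hF
  have hFabs : |F| = amp S 𝔠 X j * ((((L : ℝ) ^ j) ^ 2 + 1) / 2) := by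
    rw [hF, abs_curlAt_linAvgIter_potTE S 𝔠 X h hX0 hk hR hadm hj hp]
  have hXn : 0 < ‖X‖ := norm_pos_iff.2 hX0
  have hLj : (1 : ℝ) ≤ ((L : ℝ) ^ j) ^ 2 := by
    have : (1 : ℝ) ≤ L := by exact_mod_cast le_of_lt S.hL.2
    exact one_le_pow₀ (one_le_pow₀ this)
  have hLpos : (0 : ℝ) < (L : ℝ) ^ j := pow_pos (by exact_mod_cast lt_trans zero_lt_one S.hL.2) j
  have hXne : ‖X‖ ≠ 0 := hXn.ne'
  have hampL : amp S 𝔠 X j * ((L : ℝ) ^ j) ^ 2 * ‖X‖ = 𝔠.C68 * aj S 𝔠 j / 4 := by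
    unfold amp; field_simp
  have ha0 : 0 ≤ amp S 𝔠 X j := amp_nonneg S 𝔠 hX0 (by omega)
  have haj : 0 < aj S 𝔠 j := aj_pos S 𝔠 (by omega)
  -- the window gives `C68 a_j ≤ 1/3`
  have hsmall : 𝔠.C68 * aj S 𝔠 j ≤ 1 / 3 := by
    have hw := hwin j hj
    have hCa : 0 ≤ 𝔠.C68 * aj S 𝔠 j := mul_nonneg 𝔠.C68_pos.le haj.le
    have hd1 : (1 : ℝ) ≤ ((S.P.d : ℝ) + 2) ^ 2 := by
      have : (1 : ℝ) ≤ (S.P.d : ℝ) + 2 := by have := Nat.cast_nonneg (α := ℝ) S.P.d; linarith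
      exact one_le_pow₀ this
    have hδ3 : deltaSU (Fin N) ≤ 1 / 3 := min_le_left _ _
    nlinarith
  -- `|F|‖X‖ ≤ amp L^{2j} ‖X‖ = C68 a_j/4 ≤ π`
  have hupper : |F| * ‖X‖ ≤ Real.pi := by
    rw [hFabs]
    have h1 : amp S 𝔠 X j * ((((L : ℝ) ^ j) ^ 2 + 1) / 2) * ‖X‖ ≤ amp S 𝔠 X j * ((L : ℝ) ^ j) ^ 2 * ‖X‖ := by
      have : (((L : ℝ) ^ j) ^ 2 + 1) / 2 ≤ ((L : ℝ) ^ j) ^ 2 := by linarith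
      gcongr
    have h2 : 𝔠.C68 * aj S 𝔠 j / 4 ≤ Real.pi := by linarith [Real.pi_gt_three]
    linarith [hampL]
  -- lower bound
  have hlow := abs_mul_norm_le_of_exp hskew hupper
  have hF2 : amp S 𝔠 X j * ((L : ℝ) ^ j) ^ 2 * ‖X‖ / 2 ≤ |F| * ‖X‖ := by
    rw [hFabs]
    have : ((L : ℝ) ^ j) ^ 2 / 2 ≤ (((L : ℝ) ^ j) ^ 2 + 1) / 2 := by linarith
    have hx := mul_le_mul_of_nonneg_left this ha0
    nlinarith [norm_nonneg X]
  -- `a_j ≤ C68 a_j/(4π) ≤ (2/π)|F|‖X‖ ≤ ‖exp − 1‖`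
  have hpi : 0 < Real.pi := Real.pi_pos
  have key : eps1Of S 𝔠.lane.carrier j ≤ 2 / Real.pi * (|F| * ‖X‖) := by
    change aj S 𝔠 j ≤ _
    have h1 : aj S 𝔠 j ≤ 𝔠.C68 * aj S 𝔠 j / (4 * Real.pi) := by
      rw [le_div_iff₀ (by positivity)]; nlinarith
    have h2 : 𝔠.C68 * aj S 𝔠 j / (4 * Real.pi) = 2 / Real.pi * (𝔠.C68 * aj S 𝔠 j / 4 / 2) := by field_simp
    rw [h2] at h1
    refine h1.trans (mul_le_mul_of_nonneg_left ?_ (by positivity))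
    linarith [hampL]
  refine key.trans ?_
  calc 2 / Real.pi * (|F| * ‖X‖) ≤ 2 / Real.pi * (Real.pi / 2 * ‖exp (((F : ℝ) : ℂ) • X) - 1‖) :=
        mul_le_mul_of_nonneg_left hlow (by positivity)
    _ = ‖exp (((F : ℝ) : ℂ) • X) - 1‖ := by field_simp

end LargeRec

end Summit.QuantumFields.YangMills.Theorems.ProfileEnlarged

/-! ## §3 At the T³ objects: `profE ∈ large67RecSet` — the row (U2) BY NAME -/

namespace Summit.QuantumFields.YangMills.Theorems

open Literature.MathematicalPhysics.QuantumFieldTheory.Balaban1983to89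
open Literature.MathematicalPhysics.QuantumFieldTheory.Balaban1983to89.T3ContinuumYM3Torus
open Literature.MathematicalPhysics.QuantumFieldTheory.Balaban1983to89.ExpMeanLog (deltaSU)
open Literature.MathematicalPhysics.QuantumFieldTheory.Balaban1985CMP102.Setting
open Summit.QuantumFields.Balaban3D.Carriers
open Summit.QuantumFields.Balaban3D.Proofs.Primitives
open Summit.QuantumFields.YangMills.Theorems.ProfileEnlarged (CollarE collarE_mono profE eps1Of_le_dist1_plaqHol_iter_profE)
open Summit.QuantumFields.YangMills.Theorems.BalabanUVNodesN08AlphaProfileBuild (aj aj_pos)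
open B7Prop2Explicit (C0)

variable {F : T3Family} {𝔠 : AlphaConsts F.L (suGroupModel 2).N} {γ : ℝ} {hγ : 0 < γ} {hγ1 : γ ≤ (min 𝔠.gamma0 1) ^ 2} {K : ℕ}

/-- **THE WINDOW `(d+2)²·C68·g_jp(g_j) ≤ δ_{SU(2)}` AT THE RUN'S SCALES** (`j ≤ K`): from the record's [B7]-Prop-2 window ✓ `b7Window_T3` (`C₀(3)·C68·g_jp(g_j) ≤ ⅓`,
`C₀(3) = 226·224² ≥ 25`, `δ_{SU(2)} = ⅓`). [cite: Balaban1985Averaging, Prop. 2 (52)–(54) p.26] -/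
theorem AlphaInputsT3AC.recWindow_T3 {j : ℕ} (hj : j ≤ K) :
    ((3 : ℝ) + 2) ^ 2 * (𝔠.C68 * aj (T3Scales F γ hγ (hγ1.trans (sq_min_one_le _ 𝔠.gamma0_pos)) K) 𝔠 j) ≤ deltaSU (Fin 2) := by
  have h1 := (AlphaInputsT3AC.b7Window_T3 F 𝔠 γ hγ hγ1 K hj).1
  change C0 3 * (𝔠.C68 * aj (T3Scales F γ hγ (hγ1.trans (sq_min_one_le _ 𝔠.gamma0_pos)) K) 𝔠 j) ≤ 1 / 3 at h1
  have hC0 : (25 : ℝ) ≤ C0 3 := by unfold C0; norm_num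
  have ha : 0 ≤ 𝔠.C68 * aj (T3Scales F γ hγ (hγ1.trans (sq_min_one_le _ 𝔠.gamma0_pos)) K) 𝔠 j :=
    mul_nonneg 𝔠.C68_pos.le (aj_pos _ 𝔠 hj).le
  have hδ : deltaSU (Fin 2) = 1 / 3 := by
    unfold deltaSU
    rw [Fintype.card_fin]
    refine min_eq_left ?_
    rw [le_div_iff₀ (by norm_num)]
    have := Real.pi_gt_three; push_cast; linarith
  rw [hδ]
  nlinarith

/-- **★★★ (U2) — THE ENLARGED-REGION PROFILE LIES IN `large67RecSet`** (the (67) conjunct of the Sel∕Xs class `𝒞_Xs` of record, RECORDING currency): under the collar row (N2′)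
`CollarE … K` and `4π ≤ C68`, for every `k ≤ K`, every ADMISSIBLE history `h` and every direction `0 ≠ X ∈ 𝔰𝔲(2)`, `profE (T3Scales …) 𝔠 h hX ∈ AlphaInputsT3AC.large67RecSet F 𝔠 γ hγ hγ1 K k h`.
[cite: Balaban1985UV3, (7) p.257 + (40) p.266 + (67) p.273; Balaban1987RG1, (0.4) p.253] -/
theorem AlphaInputsT3AC.profE_mem_large67RecSet
    (hN2 : CollarE (T3Scales F γ hγ (hγ1.trans (sq_min_one_le _ 𝔠.gamma0_pos)) K) 𝔠 K) (hC : 4 * Real.pi ≤ 𝔠.C68)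
    {k : ℕ} (hk : k ≤ K) {h : Hist (F.P K) k}
    (hh : Hist.Admissible 𝔠.lane.carrier.M₁ (rcolOf (T3Scales F γ hγ (hγ1.trans (sq_min_one_le _ 𝔠.gamma0_pos)) K) 𝔠.lane.carrier) k h)
    {X : Matrix (Fin 2) (Fin 2) ℂ} (hX : X ∈ (suGroupModel 2).lie) (hX0 : X ≠ 0) :
    profE (T3Scales F γ hγ (hγ1.trans (sq_min_one_le _ 𝔠.gamma0_pos)) K) 𝔠 h hX ∈ AlphaInputsT3AC.large67RecSet F 𝔠 γ hγ hγ1 K k h := by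
  intro j p hp
  exact eps1Of_le_dist1_plaqHol_iter_profE (T3Scales F γ hγ (hγ1.trans (sq_min_one_le _ 𝔠.gamma0_pos)) K) 𝔠 hX h hX0 hk
    (collarE_mono _ 𝔠 hN2 hk) (fun i hi => AlphaInputsT3AC.recWindow_T3 (𝔠 := 𝔠) (hγ1 := hγ1) (by omega)) hC hh j.2 hp

/-- **★★★ THE ROW `hU2` OF ✓ `AlphaInputsT3AC.exists_inClassSelT3Xs_of_innerLift_of_collar_of_profRec` VERBATIM** (★w5-19936 g4 ⧗p623726 §5): under `CollarE … K` and `4π ≤ C68`,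
`∀ k ≤ K, ∀ h admissible, ∀ X ∈ 𝔰𝔲(2), X ≠ 0 → profE … ∈ large67RecSet …`. [cite: Balaban1985UV3, (7) p.257 + (40) p.266 + (67) p.273] -/
theorem AlphaInputsT3AC.profRec_of_collar
    (hN2 : CollarE (T3Scales F γ hγ (hγ1.trans (sq_min_one_le _ 𝔠.gamma0_pos)) K) 𝔠 K) (hC : 4 * Real.pi ≤ 𝔠.C68) :
    ∀ (k : ℕ), k ≤ K → ∀ (h : Hist (F.P K) k),
      Hist.Admissible 𝔠.lane.carrier.M₁ (rcolOf (T3Scales F γ hγ (hγ1.trans (sq_min_one_le _ 𝔠.gamma0_pos)) K) 𝔠.lane.carrier) k h →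
      ∀ (X : Matrix (Fin 2) (Fin 2) ℂ) (hX : X ∈ (suGroupModel 2).lie), X ≠ 0 →
        profE (T3Scales F γ hγ (hγ1.trans (sq_min_one_le _ 𝔠.gamma0_pos)) K) 𝔠 h hX ∈ AlphaInputsT3AC.large67RecSet F 𝔠 γ hγ hγ1 K k h :=
  fun _ hk _ hh _ hX hX0 => AlphaInputsT3AC.profE_mem_large67RecSet hN2 hC hk hh hX hX0

end Summit.QuantumFields.YangMills.Theorems

end
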